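import Summits.HodgeConjecture.HodgeConjecture.Theses.GenericDivisibility
import Summits.HodgeConjecture.HodgeConjecture.Theorems.GenericDivisibilityGenericDivisibilityBoundedThomH3TorsionFree
import Summits.HodgeConjecture.HodgeConjecture.Theorems.GenericDivisibilityGenericDivisibilityBoundedSurfaceSaturation
import Summits.HodgeConjecture.HodgeConjecture.Theorems.GenericDivisibilityHodgeClassesGenericallyDivisibleStubCoprimeAssembly
import Literature.AlgebraicGeometry.HodgeTheory.IntegralLefschetzOneOne
import Literature.AlgebraicGeometry.HodgeTheory.AlgebraicClassesHodgeTypeHolds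
import Literature.AlgebraicGeometry.HodgeTheory.HodgeTypeConjugation
import Literature.AlgebraicTopology.SingularHomology.IntegralClassRingChange
import HarnessLib

/-!
# Route GenericDivisibility — `TorsionDiesGenerically` at `p = 1`, UNCONDITIONALLY
# (torsion classes in `H²` of a Zariski open of a smooth projective surface die on a smaller open)

The route's support item `TorsionDiesGenerically` (stmt-HodgeConjecture-18850; Colliot-Thélène–Voisin
2012, Thm. 3.1, for all degrees, via the Bloch–Kato conjecture) asks, at `p = 1`: for `X` a smooth
projective complex surface, `Z ⊊ X` Zariski-closed and `w ∈ H²((X ∖ Z)(ℂ); ℤ)` with `N • w = 0`,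
`N ≥ 1`, is there a larger proper closed `Z' ⊇ Z` with `w|_{(X ∖ Z')(ℂ)} = 0`?  In degree `2`
this is classically Merkurjev–Suslin / Kummer theory + Riemann's existence theorem.  This file proves
it from theorems of the tree, with no named fact:

1. **Saturation** (line `finite-level-bootstrap` of the companion crux C2, landed:
   `stub_surfaceSaturation_of_thomNC` fed with `stub_thomH3TorsionFreeNC` — the image of
   `H²(X(ℂ); ℤ) → H²((X ∖ Z)(ℂ); ℤ)` is saturated, because `H³` of the straightened pair is
   torsion-free): `N • w = 0 = 0|`, so `w = v|_{(X ∖ Z)(ℂ)}` for some `v ∈ H²(X(ℂ); ℤ)`.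
2. `(N • v)|_{(X ∖ Z)(ℂ)} = N • w = 0`, so `(N • v) ⊗ ℂ` dies off the proper closed `Z`: it lies in
   `N¹ H²(X(ℂ); ℂ) = algebraicClasses X 1`, hence is of Hodge type `(1,1)` (Voisin I, Prop. 11.20 —
   the tree's `isOfHodgeType_of_mem_algebraicClasses_of_isSmoothProjective`), and so is
   `v ⊗ ℂ = N⁻¹ • (N • v) ⊗ ℂ`.
3. **Integral Lefschetz `(1,1)`** (the tree's `integralLefschetzOneOne`): `v` dies on `(X ∖ Z₁)(ℂ)`
   for some proper closed `Z₁`, hence `w = v|` dies on `(X ∖ (Z ∪ Z₁))(ℂ)`, and `Z ∪ Z₁ ≠ X`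
   (`X` irreducible).

* `genericDivisibility_torsionDiesGenerically_one` — the statement, in the shape of the route decl
  `TorsionDiesGenerically` with `p := 1`;
* `stub_torsionDiesGenerically_one` — the registered sub-goal of the crux item
  stmt-HodgeConjecture-18466 of that name (`TorsionDiesGenerically` at `p = 1` was the one input of its
  `p = 1` sector in `Theorems/GenericDivisibilityHodgeClassesGenericallyDivisibleSurface`).

References: J.-L. Colliot-Thélène, C. Voisin, *Cohomologie non ramifiée et conjecture de Hodge
entière*, Duke Math. J. 161 (2012), Thm. 3.1 [ColliotTheleneVoisin2012]; C. Voisin, *Hodge Theory and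
Complex Algebraic Geometry I* (2002), Prop. 11.20, Thm. 11.30, Rem. 7.9, Thm. 11.33
[VoisinHodgeI2002]; A. Hatcher, *Algebraic Topology* (2002), §3.1 p. 200 [HatcherAT2002].
-/

-- `Summit.HodgeConjecture.HodgeConjecture.Theorems` is the mandated namespace (single-problem summit:
-- Problem = Summit), which `linter.dupNamespace` flags on every declaration; the lakefile turns the
-- linter off tree-wide (weak option), restated here so stand-alone elaboration is warning-free too.
set_option linter.dupNamespace false

noncomputable section

namespace Summit.HodgeConjecture.HodgeConjecture.Theorems

open CategoryTheory AlgebraicGeometry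
open Literature.AlgebraicGeometry.Motives Literature.AlgebraicGeometry.HodgeTheory
  Literature.AlgebraicTopology.SingularHomology
open Summit.HodgeConjecture.HodgeConjecture.Theses.GenericDivisibility

/-- **`TorsionDiesGenerically` at `p = 1`, unconditionally.** For `X` a smooth projective complex
surface, `Z ⊊ X` Zariski-closed and `w ∈ H²((X ∖ Z)(ℂ); ℤ)` with `N • w = 0`, `N ≥ 1`, there is a
Zariski-closed `Z' ⊇ Z`, `Z' ≠ X`, with `w|_{(X ∖ Z')(ℂ)} = 0`: by saturation of the image of
`H²(X(ℂ); ℤ)` (`stub_surfaceSaturation_of_thomNC` + `stub_thomH3TorsionFreeNC`) `w = v|` with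
`v ∈ H²(X(ℂ); ℤ)`; `(N • v) ⊗ ℂ` dies off `Z`, so is algebraic, so of type `(1,1)`, and so is
`v ⊗ ℂ`; and an integral `(1,1)`-class dies on a non-empty Zariski open (`integralLefschetzOneOne`).
[cite: ColliotTheleneVoisin2012, Thm 3.1] [cite: VoisinHodgeI2002, Prop. 11.20 and Thm. 11.30]
[cite: HatcherAT2002, §3.1 p. 200] -/
theorem genericDivisibility_torsionDiesGenerically_one ⦃X : SchemeOver ℂ⦄
    (hX : IsSmoothProjective (2 * 1) X) (Z : Set X.left) (hZ : IsClosed Z) (hZne : Z ≠ Set.univ)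
    (w : singularCohomology ℤ ℤ (complexPointsCompl X Z) (2 * 1)) (N : ℕ) (hN : 1 ≤ N)
    (hNw : N • w = 0) :
    ∃ (Z' : Set X.left) (h : Z ⊆ Z'), IsClosed Z' ∧ Z' ≠ Set.univ ∧
      singularCohomology.map ℤ ℤ
        (⟨fun P : complexPointsCompl X Z' => (⟨P.1, fun hP : P.1.pt ∈ Z => P.2 (h hP)⟩ :
            complexPointsCompl X Z),
          continuous_subtype_val.subtype_mk fun (P : complexPointsCompl X Z') (hP : P.1.pt ∈ Z) =>
            P.2 (h hP)⟩ : C(complexPointsCompl X Z', complexPointsCompl X Z)) (2 * 1) w = 0 := by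
  haveI : IsIntegral X.left := IsSmoothProjective.isIntegral_holds hX
  -- (1) saturation: `w = v|_{(X ∖ Z)(ℂ)}` since `N • w = 0` is a restriction
  obtain ⟨v, hv⟩ := stub_surfaceSaturation_of_thomNC
    (fun S hS hSc hdisj hflat hnc ↦ stub_thomH3TorsionFreeNC S hS hSc hdisj hflat hnc)
    hX Z hZ hZne w N hN ⟨0, by rw [map_zero, hNw]⟩
  -- (2) `N • v` dies off `Z` …
  have hNv : restrictToCompl ℤ X (2 * 1) Z (N • v) = 0 := by
    change singularCohomology.map ℤ ℤ _ (2 * 1) (N • v) = 0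
    rw [map_nsmul, hv, hNw]
  -- … so its complexification is supported in codimension `≥ 1`, i.e. algebraic, i.e. of type `(1,1)`
  have hr : ∀ z ∈ Z, ((1 : ℕ) : ℕ∞) ≤ Order.coheight z :=
    (forall_one_le_coheight_iff_ne_univ hZ).2 hZne
  have hNvC : singularCohomology.ringChange (Int.castRingHom ℂ) (ComplexPoints X) (2 * 1) (N • v) ∈
      algebraicClasses X 1 := by
    refine mem_coniveauFiltration_of_restrictToCompl_eq_zero ℂ (2 * 1) hZ hr ?_
    change singularCohomology.map ℂ ℂ _ (2 * 1)
      (singularCohomology.ringChange (Int.castRingHom ℂ) (ComplexPoints X) (2 * 1) (N • v)) = 0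
    rw [← singularCohomology.ringChange_map]
    change singularCohomology.ringChange (Int.castRingHom ℂ) (complexPointsCompl X Z) (2 * 1)
      (restrictToCompl ℤ X (2 * 1) Z (N • v)) = 0
    rw [hNv, map_zero]
  have hHT : IsOfHodgeType (2 * 1) X (2 * 1) 1 1
      (singularCohomology.ringChange (Int.castRingHom ℂ) (ComplexPoints X) (2 * 1) (N • v)) :=
    isOfHodgeType_of_mem_algebraicClasses_of_isSmoothProjective hX 1 hNvC
  have hHTv : IsOfHodgeType (2 * 1) X 2 1 1
      (singularCohomology.ringChange (Int.castRingHom ℂ) (ComplexPoints X) 2 v) := by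
    have h := hHT.smul ((N : ℂ)⁻¹)
    rw [map_nsmul, ← Nat.cast_smul_eq_nsmul ℂ, smul_smul,
      inv_mul_cancel₀ (Nat.cast_ne_zero.2 (by omega)), one_smul] at h
    exact h
  -- (3) integral Lefschetz `(1,1)`: `v` dies off a proper closed `Z₁`
  obtain ⟨Z₁, hZ₁, hZ₁ne, hv0⟩ := integralLefschetzOneOne hX v hHTv
  -- (4) `Z' = Z ∪ Z₁`
  refine ⟨Z ∪ Z₁, Set.subset_union_left, hZ.union hZ₁,
    genericDivisibility_union_ne_univ hZ hZ₁ hZne hZ₁ne, ?_⟩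
  rw [← hv, ← ModuleCat.comp_apply, ← singularCohomology.map_comp]
  -- `(X ∖ (Z ∪ Z₁))(ℂ) → (X ∖ Z)(ℂ) → X(ℂ)` equals `(X ∖ (Z ∪ Z₁))(ℂ) → (X ∖ Z₁)(ℂ) → X(ℂ)`
  have hfac : (⟨Subtype.val, continuous_subtype_val⟩ :
        C(complexPointsCompl X Z, ComplexPoints X)).comp
      (⟨fun P : complexPointsCompl X (Z ∪ Z₁) =>
          (⟨P.1, fun hP : P.1.pt ∈ Z => P.2 (Set.subset_union_left hP)⟩ : complexPointsCompl X Z),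
        continuous_subtype_val.subtype_mk fun (P : complexPointsCompl X (Z ∪ Z₁))
          (hP : P.1.pt ∈ Z) => P.2 (Set.subset_union_left hP)⟩ :
        C(complexPointsCompl X (Z ∪ Z₁), complexPointsCompl X Z)) =
      (⟨Subtype.val, continuous_subtype_val⟩ :
        C(complexPointsCompl X Z₁, ComplexPoints X)).comp
      (⟨fun P : complexPointsCompl X (Z ∪ Z₁) =>
          (⟨P.1, fun hP : P.1.pt ∈ Z₁ => P.2 (Set.subset_union_right hP)⟩ : complexPointsCompl X Z₁),
        continuous_subtype_val.subtype_mk fun (P : complexPointsCompl X (Z ∪ Z₁))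
          (hP : P.1.pt ∈ Z₁) => P.2 (Set.subset_union_right hP)⟩ :
        C(complexPointsCompl X (Z ∪ Z₁), complexPointsCompl X Z₁)) := rfl
  rw [hfac, singularCohomology.map_comp, ModuleCat.comp_apply, hv0, map_zero]

/-- **Registered sub-goal `stub_torsionDiesGenerically_one` of the crux item
stmt-HodgeConjecture-18466** — the route decl `TorsionDiesGenerically` (support item
stmt-HodgeConjecture-18850) with `p` specialised to `1`, verbatim and with NO hypothesis: torsion
classes of degree `2` on a Zariski open of a smooth projective complex surface die on a smaller
Zariski open; the proof is `genericDivisibility_torsionDiesGenerically_one`.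
[cite: ColliotTheleneVoisin2012, Thm 3.1] [cite: VoisinHodgeI2002, Prop. 11.20 and Thm. 11.30] -/
theorem stub_torsionDiesGenerically_one :
    ∀ ⦃X : SchemeOver ℂ⦄, IsSmoothProjective (2 * 1) X → ∀ (Z : Set X.left), IsClosed Z →
      Z ≠ Set.univ → ∀ (w : singularCohomology ℤ ℤ (complexPointsCompl X Z) (2 * 1)) (N : ℕ),
        1 ≤ N → N • w = 0 →
        ∃ (Z' : Set X.left) (h : Z ⊆ Z'), IsClosed Z' ∧ Z' ≠ Set.univ ∧
          singularCohomology.map ℤ ℤ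
            (⟨fun P : complexPointsCompl X Z' => (⟨P.1, fun hP : P.1.pt ∈ Z => P.2 (h hP)⟩ :
                complexPointsCompl X Z),
              continuous_subtype_val.subtype_mk fun (P : complexPointsCompl X Z')
                (hP : P.1.pt ∈ Z) => P.2 (h hP)⟩ :
              C(complexPointsCompl X Z', complexPointsCompl X Z)) (2 * 1) w = 0 :=
  fun _ hX Z hZ hZne w N hN hNw ↦
    genericDivisibility_torsionDiesGenerically_one hX Z hZ hZne w N hN hNw

end Summit.HodgeConjecture.HodgeConjecture.Theorems
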